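import Literature.MathematicalPhysics.QuantumFieldTheory.Balaban1983to89.B15Sect1Instances
import Literature.MathematicalPhysics.QuantumFieldTheory.Balaban1983to89.B15Eq177GaugeInvariance
import Literature.MathematicalPhysics.QuantumFieldTheory.Balaban1983to89.Node00.LargeFieldBackgroundMSOfRecord

/-!
# `Balaban1983to89.B15Eq177ValueInvariance` — T. Bałaban, *Large field renormalization. I. The basic step of the 𝐑 operation*,
# Commun. Math. Phys. **122** (1989) 175–202 [Balaban1989LargeFieldI] = «[IV]», p. 194, the sentence after (1.77), verbatim:
# *«The function is invariant with respect to the group of all gauge transformations defined on Λ, hence it is natural to consider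
# it on orbits of this group.»* — PROVED for the function (1.77) `V_k ↦ A(U_{k,Z}(V_k))` AT THE TOTALISED (2.12) SOLUTION MAP OF
# RECORD (`Node00.bgOfRecord av reg`: a minimiser of the Wilson action in a regularity class `reg` under the averaging constraints, CHOSEN
# when one exists, the unit configuration otherwise), for EVERY gauge-invariant class `reg`, WITHOUT the configuration-level covariance
# [15] (181); and the kernel certificate that (181) in its configuration-level form `B15Eq177GaugeInvariance.Cov181` FAILS at that map.

statement-level skeleton of published theorems with citation tags; proofs where landed; nothing here is a claim about the Yang–Mills mass gap

[15] = T. Bałaban, *The variational problem and background fields in renormalization group method for lattice gauge theories*, Commun.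
Math. Phys. **102** (1985) 277–309 [Balaban1985Variational], (181) p. 307, verbatim: *«For the minimal configurations in the axial gauge we
have U_k(V^v) = U_k(V)^{v̄}, (181) where v̄ is constant on blocks B^j(y), y ∈ Λ_j, and equal to v(y)»*; [III] = T. Bałaban, *Convergent
renormalization expansions for lattice gauge theories*, Commun. Math. Phys. **119** (1988) 243–285 [Balaban1988Convergent], (2.12) p. 256.

WHY (cell `pub-ymgap`, seat dag-n12-c g6, node N12 [B15] strategy s1; LOCATED-181, 2026-08-27).  Every endpoint of the N12∕s1 chain for
Proposition 1 [IV] (`B15Prop1StdInstanceSU2Box` … `B15Prop1IntrinsicAnalyticAtRecord`) carries the letter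
`h181 : ∀ u, Cov181 bg (Bj M₁ Z k) (blockLift k u)` — `U(𝔹, V′) = U(𝔹, V)^{ū}` for ALL multi-scale data `V, V′` related by `ū` — and
uses it ONLY through the value invariance `A(U_{k,Z}(V_k^u)) = A(U_{k,Z}(V_k))` (`B15Eq177GaugeInvariance.fun177_gaugeAct`,
`B15Prop1Carrier.std_f_gaugeAct`).  At NODE 00's solution maps of record (`Node00.bgOfRecord`, hence `Node00.bgMSOfRecord`,
`Node00.bgMSCoOfRecord` and their editions) the configuration-level letter is NOT satisfiable: off the solvable set the totalised map is the
unit configuration and `1^{ū} ≠ 1` for a non-constant `ū` (§4, `not_cov181_bgOfRecord`); on it a CHOSEN minimiser is covariant only up to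
the residual gauge (print's (181) is stated for the representative *«in the axial gauge»*, which the record does not take).  The VALUE
invariance, which is all Proposition 1 needs, holds at the record unconditionally (§3): the (2.12) problems for `ū`-related data are carried
onto each other by `U₀ ↦ U₀^{ū}` (§1), so their minimum values agree, and the junk branches agree (§2).  The companion modules
`B15Prop1LocalLettersOfFun` ∕ `B15Prop1IntrinsicOfFun` re-thread the live s1 path over the value-invariance letter.

WHAT IS CERTIFIED (kernel, sorry-free; axioms `propext`∕`Classical.choice`∕`Quot.sound`).  `P : Params`, `G` a `GaugeGroup`, `av` a
family of averaging operations, `reg ⊆` fine configurations INVARIANT under every gauge transformation of `T_η` (`hreg`), `𝔹` a determining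
set living in the standing range (`𝔹_j = ∅` for `j > m + K` — the `Setup` RANGE GUARD, as in `B14Eq216Concrete.agreeOn_avgFamily`), data
`V, V′` RELATED BY `ū` (`V′_j = V_j^{ū↾T^{(j)}}` for `j ≤ m + K`, the premise of `Cov181`).
* §1 `agreeOn_gaugeAct_of_related`, `related_symm`, ★ `isMinimizer_gaugeAct_of_related` — a (2.12) minimiser `U₀` for `V` gives the
  minimiser `U₀^{ū}` for `V′` (class invariance `hreg`, covariance of `M^j` = r13's `B16Sect1Backgrounds.iter_gaugeAct`, `A(U^u) = A(U)` =
  r11's `B14Eq16FaddeevPopov.wilsonAction4_gaugeAct'`); `mem_solvableDom_iff_of_related`; `wilsonAction4_eq_of_isMinimizer` (two minimisers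
  of one problem have one action).
* §2 ★ `wilsonAction4_UminOfRecord_of_related` — `A(U(𝔹, V′)) = A(U(𝔹, V))` for the totalised solution map of record (both branches).
* §3 ★★ `fun177std_bgOfRecord_gaugeAct` — **p. 194's sentence at the record**: `A(U_{k,Z}(V_k^u)) = A(U_{k,Z}(V_k))` for EVERY gauge
  transformation `u` of `T^{(k)}` (`k ≤ m + K`), at `bg := bgOfRecord av reg`; `fun177_bgOfRecord_gaugeAct` (r12's `fun177` form),
  `gaugeInvariant_fun177std_bgOfRecord`.
* §4 ★ `not_cov181_bgOfRecord` — ANTI-VACUITY CERTIFICATE for the letter it replaces: if some datum is unsolvable and `ū` moves the unit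
  configuration (`gaugeAct_one_ne_one`: `ū(b₋) ≠ ū(b₊)` on one bond), then `¬ Cov181 (bgOfRecord av reg) 𝔹 ū`.
* §5 at NODE 00's multi-scale class of record: `gaugeAct_mem_regMSOfRecord` ([6] (1.7) is gauge invariant) and
  ★ `fun177std_bgMSOfRecord_gaugeAct` (p. 194's sentence for `bgMSOfRecord F N ν K k Ω`, every `SU(N)`).

HONEST FRAMING: count-neutral kernel work on Bałaban AS PRINTED; nothing of [15] Thm 1 (existence ∕ uniqueness of minimisers) is asserted or
used; nothing continuum ∕ OS ∕ mass-gap ∕ Clay; N12 not discharged.  No `def`, no instance, no notation, no `sorry`.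
-/

noncomputable section

namespace Literature.MathematicalPhysics.QuantumFieldTheory.Balaban1983to89.B15Eq177ValueInvariance

open Literature.MathematicalPhysics.QuantumFieldTheory.Balaban1983to89
open B15DeterminingSets B14.Eq213DetSet B14.Eq216Concrete GaugeField B16Sect1Backgrounds B15Eq177GaugeInvariance
open B15Sect1Instances Node00
open Literature.MathematicalPhysics.QuantumFieldTheory.BalabanImbrieJaffe1984to88.BIJ85Eq453GaugeField

variable {P : Params} {G : Type*} [GaugeGroup G]

/-! ## §1  Data related by a gauge transformation of `T_η`, and the transport of (2.12) minimisers -/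

/-- If `U₀` realises the data `V` on `𝔹` (`M^j(U₀) = V_j` on the bonds of `𝔹_j`), then `U₀^{ū}` realises the `ū`-related data `V′`
(`V′_j = V_j^{ū↾T^{(j)}}` in the standing range; `𝔹` lives in that range) — covariance of the averages, r13's
`B16Sect1Backgrounds.iter_gaugeAct`. [cite: Balaban1988Convergent, (2.10)–(2.12) p.256; Balaban1985Averaging, (11) p.19] -/
theorem agreeOn_gaugeAct_of_related (av : ∀ j, Averaging P j G) {𝔹 : DetSet P} (h𝔹 : ∀ j, P.m + P.K < j → 𝔹 j = ∅)
    (ū : GaugeTransf P 0 G) {V V' : MSField P G} (hVV' : ∀ j, j ≤ P.m + P.K → V' j = gaugeAct (toMS ū j) (V j))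
    {U₀ : GaugeField P 0 G} (h : AgreeOn 𝔹 (avgFamily av U₀) V) :
    AgreeOn 𝔹 (avgFamily av (gaugeAct ū U₀)) V' := by
  intro j b hb
  by_cases hj : j ≤ P.m + P.K
  · have h1 : avgFamily av (gaugeAct ū U₀) j = gaugeAct (toMS ū j) (avgFamily av U₀ j) := iter_gaugeAct av ū U₀ j hj
    rw [h1, hVV' j hj]
    simp only [gaugeAct, h j b hb]
  · rw [h𝔹 j (not_le.1 hj)] at hb
    simp [bondsOf] at hb

/-- Relatedness by `ū` is undone by `ū⁻¹` (`invG ū`). [cite: Balaban1985Averaging, (8) p.18] -/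
theorem related_symm (ū : GaugeTransf P 0 G) {V V' : MSField P G}
    (hVV' : ∀ j, j ≤ P.m + P.K → V' j = gaugeAct (toMS ū j) (V j)) :
    ∀ j, j ≤ P.m + P.K → V j = gaugeAct (toMS (invG ū) j) (V' j) := by
  intro j hj
  rw [hVV' j hj]
  funext b
  simp [gaugeAct, toMS, invG, mul_assoc]

/-- **TRANSPORT OF (2.12) MINIMISERS**: for a gauge-invariant class `reg`, a minimiser `U₀` of the Wilson action in `reg` under the
constraints `M_𝔹(U) = V` gives the minimiser `U₀^{ū}` under the constraints `M_𝔹(U) = V′` for the `ū`-related data `V′` — the problems are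
carried onto each other by `U ↦ U^{ū}` (class invariance, covariance of `M^j`, `A(U^{ū}) = A(U)`).  The MECHANISM behind [15] (181) at the level
of minimal SETS; nothing about uniqueness. [cite: Balaban1985Variational, (181) p.307; Balaban1988Convergent, (2.12) p.256] -/
theorem isMinimizer_gaugeAct_of_related (av : ∀ j, Averaging P j G) {reg : Set (GaugeField P 0 G)}
    (hreg : ∀ (w : GaugeTransf P 0 G) (U : GaugeField P 0 G), U ∈ reg → gaugeAct w U ∈ reg)
    {𝔹 : DetSet P} (h𝔹 : ∀ j, P.m + P.K < j → 𝔹 j = ∅) (ū : GaugeTransf P 0 G) {V V' : MSField P G}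
    (hVV' : ∀ j, j ≤ P.m + P.K → V' j = gaugeAct (toMS ū j) (V j)) {U₀ : GaugeField P 0 G}
    (h : IsMinimizer av reg 𝔹 V U₀) : IsMinimizer av reg 𝔹 V' (gaugeAct ū U₀) := by
  refine ⟨hreg ū U₀ h.1, agreeOn_gaugeAct_of_related av h𝔹 ū hVV' h.2.1, fun U hU hUV => ?_⟩
  -- pull the competitor back by `ū⁻¹`
  have hUV' : AgreeOn 𝔹 (avgFamily av (gaugeAct (invG ū) U)) V :=
    agreeOn_gaugeAct_of_related av h𝔹 (invG ū) (related_symm ū hVV') hUV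
  have hle := h.2.2 (gaugeAct (invG ū) U) (hreg _ U hU) hUV'
  rw [B14Eq16FaddeevPopov.wilsonAction4_gaugeAct'] at hle
  rw [B14Eq16FaddeevPopov.wilsonAction4_gaugeAct']
  exact hle

/-- The solvable sets of `ū`-related data coincide (one direction). [cite: Balaban1988Convergent, (2.12) p.256] -/
theorem mem_solvableDom_of_related (av : ∀ j, Averaging P j G) {reg : Set (GaugeField P 0 G)}
    (hreg : ∀ (w : GaugeTransf P 0 G) (U : GaugeField P 0 G), U ∈ reg → gaugeAct w U ∈ reg)
    {𝔹 : DetSet P} (h𝔹 : ∀ j, P.m + P.K < j → 𝔹 j = ∅) (ū : GaugeTransf P 0 G) {V V' : MSField P G}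
    (hVV' : ∀ j, j ≤ P.m + P.K → V' j = gaugeAct (toMS ū j) (V j)) (hV : V ∈ solvableDom av reg 𝔹) :
    V' ∈ solvableDom av reg 𝔹 := by
  obtain ⟨U₀, hU₀⟩ := hV
  exact ⟨_, isMinimizer_gaugeAct_of_related av hreg h𝔹 ū hVV' hU₀⟩

/-- The solvable sets of `ū`-related data coincide. [cite: Balaban1988Convergent, (2.12) p.256] -/
theorem mem_solvableDom_iff_of_related (av : ∀ j, Averaging P j G) {reg : Set (GaugeField P 0 G)}
    (hreg : ∀ (w : GaugeTransf P 0 G) (U : GaugeField P 0 G), U ∈ reg → gaugeAct w U ∈ reg)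
    {𝔹 : DetSet P} (h𝔹 : ∀ j, P.m + P.K < j → 𝔹 j = ∅) (ū : GaugeTransf P 0 G) {V V' : MSField P G}
    (hVV' : ∀ j, j ≤ P.m + P.K → V' j = gaugeAct (toMS ū j) (V j)) :
    V' ∈ solvableDom av reg 𝔹 ↔ V ∈ solvableDom av reg 𝔹 :=
  ⟨mem_solvableDom_of_related av hreg h𝔹 (invG ū) (related_symm ū hVV'),
    mem_solvableDom_of_related av hreg h𝔹 ū hVV'⟩

/-- Two minimisers of ONE (2.12) problem have the same action (each is `≤` the other). [cite: Balaban1988Convergent, (2.12) p.256] -/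
theorem wilsonAction4_eq_of_isMinimizer (av : ∀ j, Averaging P j G) {reg : Set (GaugeField P 0 G)} {𝔹 : DetSet P}
    {V : MSField P G} {U₀ U₁ : GaugeField P 0 G} (h₀ : IsMinimizer av reg 𝔹 V U₀) (h₁ : IsMinimizer av reg 𝔹 V U₁) :
    wilsonAction4 U₀ = wilsonAction4 U₁ :=
  le_antisymm (h₀.2.2 U₁ h₁.1 h₁.2.1) (h₁.2.2 U₀ h₀.1 h₀.2.1)

/-! ## §2  The totalised solution map of record: `A(U(𝔹, V′)) = A(U(𝔹, V))` for related data (both branches) -/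

section SolutionMap

variable [MeasurableSpace G]

/-- **VALUE INVARIANCE OF THE (2.12) SOLUTION MAP OF RECORD**: for `ū`-related data the totalised map `Node00.UminOfRecord` (a chosen
minimiser on the solvable set, the unit configuration off it) has equal Wilson actions — on the solvable set both values are the common
minimum (§1), off it both configurations are the unit. [cite: Balaban1988Convergent, (2.12) p.256; Balaban1985Variational, (181) p.307] -/
theorem wilsonAction4_UminOfRecord_of_related (av : ∀ j, Averaging P j G) {reg : Set (GaugeField P 0 G)}
    (hreg : ∀ (w : GaugeTransf P 0 G) (U : GaugeField P 0 G), U ∈ reg → gaugeAct w U ∈ reg)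
    {𝔹 : DetSet P} (h𝔹 : ∀ j, P.m + P.K < j → 𝔹 j = ∅) (ū : GaugeTransf P 0 G) {V V' : MSField P G}
    (hVV' : ∀ j, j ≤ P.m + P.K → V' j = gaugeAct (toMS ū j) (V j)) :
    wilsonAction4 (UminOfRecord av reg 𝔹 V') = wilsonAction4 (UminOfRecord av reg 𝔹 V) := by
  by_cases hV : ∃ U₀, IsMinimizer av reg 𝔹 V U₀
  · obtain ⟨U₀, hU₀⟩ := hV
    have h1 : IsMinimizer av reg 𝔹 V (UminOfRecord av reg 𝔹 V) := Node00.isMinimizer_UminOfRecord av reg ⟨U₀, hU₀⟩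
    have h2 : IsMinimizer av reg 𝔹 V' (UminOfRecord av reg 𝔹 V') :=
      Node00.isMinimizer_UminOfRecord av reg ⟨_, isMinimizer_gaugeAct_of_related av hreg h𝔹 ū hVV' hU₀⟩
    have h3 : IsMinimizer av reg 𝔹 V' (gaugeAct ū (UminOfRecord av reg 𝔹 V)) :=
      isMinimizer_gaugeAct_of_related av hreg h𝔹 ū hVV' h1
    rw [wilsonAction4_eq_of_isMinimizer av h2 h3, B14Eq16FaddeevPopov.wilsonAction4_gaugeAct']
  · have hV' : ¬ ∃ U₀, IsMinimizer av reg 𝔹 V' U₀ := fun ⟨U₀, hU₀⟩ =>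
      hV ⟨_, isMinimizer_gaugeAct_of_related av hreg h𝔹 (invG ū) (related_symm ū hVV') hU₀⟩
    rw [Node00.UminOfRecord_of_not av reg hV, Node00.UminOfRecord_of_not av reg hV']

end SolutionMap

/-! ## §3  p. 194: *«The function is invariant with respect to the group of all gauge transformations defined on Λ»* — at the record -/

section Eq177

variable [MeasurableSpace G]

/-- No member of `𝐁_k(Z)` above the standing range when `k ≤ m + K`. [cite: Balaban1988Convergent, (2.13) pp.256–257 (bookkeeping)] -/
theorem Bj_eq_empty_of_range (M₁ : ℕ) (Z : Set (Site P 0)) {k : ℕ} (hk : k ≤ P.m + P.K) :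
    ∀ j, P.m + P.K < j → Bj M₁ Z k j = ∅ := fun _ hj =>
  Bj_of_gt (lt_of_le_of_lt hk hj)

/-- **(1.77) IS GAUGE INVARIANT AT THE SOLUTION MAP OF RECORD** (r12's `fun177` form): `A(U_{k,Z}(V_k^u)) = A(U_{k,Z}(V_k))` for
every gauge transformation `u` of `T^{(k)}` (`k ≤ m + K`), `U_{k,Z} = U(𝐁_k(Z), M˙(Q_k^{s*}·))` with `U := Node00.bgOfRecord av reg` and a
gauge-invariant class `reg` — WITHOUT [15] (181): `Q_k^{s*}(V^u) = (Q_k^{s*}V)^{ū}` (`qsstarGIter0_gaugeAct`), `M˙((·)^{ū}) = M˙(·)^{ū↾}`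
(`iter_gaugeAct`), then §2. [cite: Balaban1989LargeFieldI, (1.77) p.194] -/
theorem fun177_bgOfRecord_gaugeAct (av : ∀ j, Averaging P j G) {reg : Set (GaugeField P 0 G)}
    (hreg : ∀ (w : GaugeTransf P 0 G) (U : GaugeField P 0 G), U ∈ reg → gaugeAct w U ∈ reg)
    (M₁ : ℕ) (Z : Set (Site P 0)) {k : ℕ} (hk : k ≤ P.m + P.K) (u : GaugeTransf P k G) (Vk : GaugeField P k G) :
    fun177 (bgOfRecord av reg) (Bj M₁ Z k) (qsstarGIter0 k) (gaugeAct u Vk) =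
      fun177 (bgOfRecord av reg) (Bj M₁ Z k) (qsstarGIter0 k) Vk := by
  unfold fun177 bgKZ
  rw [Node00.bgOfRecord_U, qsstarGIter0_gaugeAct k hk u Vk]
  exact wilsonAction4_UminOfRecord_of_related av hreg (Bj_eq_empty_of_range M₁ Z hk) (blockLift k u)
    (fun j hj => iter_gaugeAct av (blockLift k u) (qsstarGIter0 k Vk) j hj)

/-- **p. 194'S SENTENCE AT THE RECORD, print's instance (1.77) `fun177std`**: `A(U_{k,Z}(V_k^u)) = A(U_{k,Z}(V_k))` for every gauge
transformation `u` of `T^{(k)}` (in particular those *«defined on Λ»*), at NODE 00's solution map of record `bgOfRecord av reg` over ANY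
gauge-invariant class `reg`, `k ≤ m + K` — the value-invariance letter of the N12∕s1 chain DISCHARGED at the record. [cite: Balaban1989LargeFieldI, (1.77) p.194] -/
theorem fun177std_bgOfRecord_gaugeAct (av : ∀ j, Averaging P j G) {reg : Set (GaugeField P 0 G)}
    (hreg : ∀ (w : GaugeTransf P 0 G) (U : GaugeField P 0 G), U ∈ reg → gaugeAct w U ∈ reg)
    (M₁ : ℕ) (Z : Set (Site P 0)) {k : ℕ} (hk : k ≤ P.m + P.K) (u : GaugeTransf P k G) (Vk : GaugeField P k G) :
    fun177std (bgOfRecord av reg) M₁ Z k (gaugeAct u Vk) = fun177std (bgOfRecord av reg) M₁ Z k Vk :=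
  fun177_bgOfRecord_gaugeAct av hreg M₁ Z hk u Vk

/-- (1.77) at the record as `GaugeField.GaugeInvariant` ([12] (12)–(13)). [cite: Balaban1989LargeFieldI, (1.77) p.194] -/
theorem gaugeInvariant_fun177std_bgOfRecord (av : ∀ j, Averaging P j G) {reg : Set (GaugeField P 0 G)}
    (hreg : ∀ (w : GaugeTransf P 0 G) (U : GaugeField P 0 G), U ∈ reg → gaugeAct w U ∈ reg)
    (M₁ : ℕ) (Z : Set (Site P 0)) {k : ℕ} (hk : k ≤ P.m + P.K) :
    GaugeInvariant (fun177std (bgOfRecord av reg) M₁ Z k) :=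
  fun u Vk => fun177std_bgOfRecord_gaugeAct av hreg M₁ Z hk u Vk

end Eq177

/-! ## §4  Anti-vacuity: the configuration-level (181) letter `Cov181` FAILS at the totalised solution map of record -/

/-- A gauge transformation that differs at the two ends of one bond moves the unit configuration. [cite: Balaban1985Averaging, (8) p.18] -/
theorem gaugeAct_one_ne_one {j : ℕ} {ū : GaugeTransf P j G} (b : PBond P j) (hb : ū b.src ≠ ū b.tgt) :
    gaugeAct ū (fun _ : PBond P j => (1 : G)) ≠ fun _ => 1 := by
  intro h
  have hb' := congrFun h b
  simp only [gaugeAct, mul_one, mul_inv_eq_one] at hb'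
  exact hb hb'

/-- **THE LETTER `h181` OF THE s1 CHAIN IS NOT SATISFIABLE AT THE RECORD**: if some multi-scale datum `V` is unsolvable for `𝔹` in
the class `reg` (e.g. a rough datum, `Node00.not_mem_solvableDom_regLF_of_le_plaq`) and `ū` moves the unit configuration, then the
configuration-level covariance `Cov181 (bgOfRecord av reg) 𝔹 ū` is FALSE: the `ū`-related datum `V^{ū}` is unsolvable too (§1), both
values of the totalised map are the unit configuration, and `1 ≠ 1^{ū}`.  (Print's (181) is stated for the representative *«in the axial
gauge»*; the record takes a chosen minimiser and the unit as junk — the VALUE invariance §3 is what survives, and what Proposition 1 uses.)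
[cite: Balaban1985Variational, (181) p.307; Balaban1988Convergent, (2.12) p.256] -/
theorem not_cov181_bgOfRecord [MeasurableSpace G] (av : ∀ j, Averaging P j G) {reg : Set (GaugeField P 0 G)}
    (hreg : ∀ (w : GaugeTransf P 0 G) (U : GaugeField P 0 G), U ∈ reg → gaugeAct w U ∈ reg)
    {𝔹 : DetSet P} (h𝔹 : ∀ j, P.m + P.K < j → 𝔹 j = ∅) {ū : GaugeTransf P 0 G}
    (hū : gaugeAct ū (fun _ : PBond P 0 => (1 : G)) ≠ fun _ => 1) {V : MSField P G} (hV : V ∉ solvableDom av reg 𝔹) :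
    ¬ Cov181 (bgOfRecord av reg) 𝔹 ū := by
  intro h
  have hV0 : ¬ ∃ U₀, IsMinimizer av reg 𝔹 V U₀ := hV
  have hVV' : ∀ j, j ≤ P.m + P.K → msGaugeAct (toMS ū) V j = gaugeAct (toMS ū j) (V j) := fun j _ => rfl
  have hV' : ¬ ∃ U₀, IsMinimizer av reg 𝔹 (msGaugeAct (toMS ū) V) U₀ := fun ⟨U₀, hU₀⟩ =>
    hV0 ⟨_, isMinimizer_gaugeAct_of_related av hreg h𝔹 (invG ū) (related_symm ū hVV') hU₀⟩
  have hcov := h V (msGaugeAct (toMS ū) V) hVV'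
  rw [Node00.bgOfRecord_U, Node00.UminOfRecord_of_not av reg hV0, Node00.UminOfRecord_of_not av reg hV'] at hcov
  exact hū hcov.symm

/-! ## §5  At NODE 00's multi-scale class `U_k({Ω_j}, εreg)` of record ([6] (1.7)): the class is gauge invariant, hence §3 applies -/

section Record

open T4Continuum Node00

variable {F : T4Family} {N : ℕ} [NeZero N]

/-- [6] (1.7)'s class `U_k({Ω_j}, εreg)` of record (`Node00.regMSOfRecord`, plaquette conditions scale by scale) is GAUGE INVARIANT
(`|U^u(∂p) − 1| = |U(∂p) − 1|`, `T4ReTrLipUnitary.plaqSmallOn_gaugeAct_iff`) — [15] p. 278 *«The spaces … are invariant»*.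
[cite: Balaban1985RegularSpaces, (1.7) p.77; Balaban1985Variational, p.278] -/
theorem gaugeAct_mem_regMSOfRecord (ν : Stage7Numerics) (K k : ℕ) (Ω : ℕ → Set (Site (F.P K) 0))
    (w : GaugeTransf (F.P K) 0 (SU N)) (U : GaugeField (F.P K) 0 (SU N)) (hU : U ∈ regMSOfRecord F N ν K k Ω) :
    gaugeAct w U ∈ regMSOfRecord F N ν K k Ω := by
  rw [mem_regMSOfRecord_iff] at hU ⊢
  intro j hj
  exact (T4ReTrLipUnitary.plaqSmallOn_gaugeAct_iff _ _ w U).2 (hU j hj)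

/-- **p. 194'S SENTENCE AT NODE 00'S BACKGROUND OF A SEQUENCE IN PRINT'S CLASS** (`Node00.bgMSOfRecord F N ν K k Ω`, every `SU(N)`):
`A(U_{k′,Z}(V^u)) = A(U_{k′,Z}(V))` for every gauge transformation `u` of `T^{(k′)}`, `k′ ≤ m + K`. [cite: Balaban1989LargeFieldI, (1.77) p.194] -/
theorem fun177std_bgMSOfRecord_gaugeAct (ν : Stage7Numerics) (K k : ℕ) (Ω : ℕ → Set (Site (F.P K) 0)) (M₁ : ℕ)
    (Z : Set (Site (F.P K) 0)) {k' : ℕ} (hk' : k' ≤ (F.P K).m + (F.P K).K) (u : GaugeTransf (F.P K) k' (SU N))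
    (Vk : GaugeField (F.P K) k' (SU N)) :
    fun177std (bgMSOfRecord F N ν K k Ω) M₁ Z k' (gaugeAct u Vk) = fun177std (bgMSOfRecord F N ν K k Ω) M₁ Z k' Vk :=
  fun177std_bgOfRecord_gaugeAct (avOfRecord F N K) (gaugeAct_mem_regMSOfRecord ν K k Ω) M₁ Z hk' u Vk

end Record

end Literature.MathematicalPhysics.QuantumFieldTheory.Balaban1983to89.B15Eq177ValueInvariance

end
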